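import Mathlib
import Summits.QuantumFields.YangMills.Theorems.SmallFieldWideningLargeFieldMassRefinementTailGaussianRung
import Summits.QuantumFields.YangMills.Theorems.CoarseStiffnessTailCappedCoarseStiffnessLGaussianSumSq
import HarnessLib

/-!
# Route `CoarseStiffnessTail`, crux `CappedCoarseStiffnessL` (stmt-QuantumFields-25301) — THE GAUSSIAN (LINEARISED, LATTICE-MAXWELL-TYPE)
# INSTANCE OF THE CRUX AS A KERNEL THEOREM (2/2; the route's CHEAPEST FALSIFIER (i), «done analytically, PASSES» in the route text)

Prover seat `ym-line-cst-p1` g11 (2026-08-28), `--supports stmt-QuantumFields-25301` (helper; the crux stays OPEN).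

WHAT.  The crux asks, for the interacting `SU(2)` law at cut-off `K`, that the quadratic tilt
`exp(c₀·β_{K−j}·Σ_{a ∈ Plaq_j} min(|Ū^j(∂a) − 1|², θ(K−j)²))` of the level-`j` AVERAGED plaquette field have free energy `≤ C₀` per level-`j`
plaquette, constants `(c₀, C₀, γ₁)` before `(F, γ, K, j)`.  Its linearised model (route text, CHEAPEST FALSIFIER (i)): the fine field is a centred
GAUSSIAN one-form whose plaquette curls have covariance `≤ g_K²·Id = β_K⁻¹·Id` (lattice Maxwell at inverse coupling `β_K`, in any gauge, is the
example; as in the sibling `SFWGaussianRung` the Gaussian law is a HYPOTHESIS, here presented as a linear image `ξ ↦ A ξ` of a standard Gaussian vector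
`ξ ∼ stdGaussian E` — every centred Gaussian vector is of this form), Bałaban's averaging is its linearisation `linAvgIter` (the tree's typing of
[Balaban1987RG1] (0.4)/(0.11)) and `|Ū^j(∂a) − 1|` is the curl of the averaged one-form.  THIS FILE PROVES, with no cap and no window:

  `∫ exp(c₀·β·Σ_{y ∈ Site_s} curl(linAvgIter s (A ξ))(y; μ, ν)²) d stdGaussian(ξ) ≤ exp(c₀/(1 − 2c₀) · #Site_s)`   (`gaussianInstance`)

for EVERY `0 ≤ c₀ < 1/2`, every height `s ≤ m + K`, every volume and block size, whenever `β·σ²·L^s ≤ 1` (`d = 3`); in the crux's own dictionary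
`β = β_{K−j} = (γL^{−(K−j)})⁻¹`, `σ² = g_K² = γL^{−K}` one has `β_{K−j} g_K² L^j = 1` (`gaussianInstance_cruxDictionary`).  So the crux's constant
structure `∃ (c₀, C₀, γ₁) ∀ (F, γ, K, j)` holds in the Gaussian model with `C₀ = c₀/(1 − 2c₀)` per plaquette and orientation and `γ₁ = 1` (no coupling
condition), uniformly in `K`, `j`, `m`, `L` — the JOINT statement (all level-`j` plaquettes tilted at once, volume factor `e^{C₀#}`), not only the
per-plaquette variance `≤ g_{K−j}²` of `SFWGaussianRung.variance_curl_linAvgIter_le_T3`.  The bound is proved for EVERY SUB-FAMILY `S` of level-`s`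
plaquettes with `#S` in place of `#Site_s` (`gaussianInstance_family`: no volume factor), whence the VOLUME-FREE joint tail
`stdGaussian{∀ y ∈ S, θ ≤ |curl_y|} ≤ exp(−(c₀βθ² − c₀/(1−2c₀))·#S)` (`gaussian_jointTail_family`: with `βθ² = p(g)²` the joint Peierls bound at rate `c₀p²` per
member for ALL families — the Gaussian form of the EDGE stub in the strong packaging of p635820 §3 / the owner's v5q).  §4: the capped tilt and the Gaussian
forms of BOTH registered stubs (`stub_subThresholdStiffness` = BULK, `stub_uniformLargeFieldCountPos` = EDGE) follow by pointwise domination.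

HOW.  The toolkit file (1/2) `…GaussianSumSq`: (§1) `∫ exp(Σ_y ℓ_y²) ≤ exp(Σ_y Var ℓ_y/(1 − 2κ))` under the operator bound `Var(Σ η_y ℓ_y) ≤ κ|η|²`;
(§2) the Schur test.  Here (§3): with the (0.4) weight `V` of `SFWGaussianRung.exists_weight` (row sums `(L²)^s`, column sums `≤ (L^{2−d})^s`) the
functionals `ℓ_y = √(c₀β)·curl(linAvgIter s (A·))(y) = √(c₀β)·Σ_p V_{yp}·curl(A·)(p)` have operator constant `κ = c₀·βσ²·L^s ≤ c₀` and diagonal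
`Σ_y Var ℓ_y ≤ c₀·#Site_s`: the operator norm of `VVᵀ` is `≤ L^s` while its trace is `#Site_s·L^s` — THIS is the structural fact behind «free energy
O(1) per level-`j` plaquette» (the crude bound `⟨F, VᵀVF⟩ ≤ ‖VᵀV‖·|F|²` would give `O(L^{3s})` per level-`s` plaquette, the disease of every elementary
road to the crux recorded in `Cruxes/CappedCoarseStiffnessL/Lines/birth.md` §g9–§g10).

HONEST SCOPE.  A theorem about GAUSSIAN one-forms and the LINEAR averaging: nothing of Bałaban's (5)/(70)/(71) is proved; the interacting law, the
nonlinear averaging and `dist1` are not touched; the crux `CappedCoarseStiffnessL`, both registered stubs and rung R3 stay OPEN.  R3 is a RECORD rung,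
not Clay; `YM3TorusSU2` is NOT proved; the Yang–Mills mass gap is NOT proved or addressed.

References: T. Bałaban, CMP 109 (1987) 249–301 [Balaban1987RG1] ((0.4), (0.11) p.253); CMP 102 (1985) 255–275 [Balaban1985UV3] ((7) p.257,
(71) p.273: the thresholds `θ(k) = g_k p(g_k)` and the large-field factor the crux's dictionary is calibrated to).
-/

set_option autoImplicit false

noncomputable section

namespace Summit.QuantumFields.YangMills.Theorems.CoarseStiffnessTailGaussianInstance

open scoped BigOperators RealInnerProductSpace
open MeasureTheory ProbabilityTheory Real
open Summit.QuantumFields.YangMills.Theorems.CoarseStiffnessTailGaussianSumSq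

/-! ## §3 The Gaussian instance of the crux: the quadratic tilt of the linearly averaged curls of a Gaussian one-form (sub-families, all plaquettes, joint tails) -/

section Instance

open Literature.MathematicalPhysics.QuantumFieldTheory.Balaban1983to89
open Summit.QuantumFields.YangMills.Theorems.AbelianEML
open Summit.QuantumFields.YangMills.Theorems.SFWGaussianRung (exists_weight)

variable {P : Params}
variable {E : Type*} [NormedAddCommGroup E] [InnerProductSpace ℝ E] [FiniteDimensional ℝ E] [MeasurableSpace E] [BorelSpace E]

omit [FiniteDimensional ℝ E] [MeasurableSpace E] [BorelSpace E] in
/-- The curl at a fine plaquette of a linearly parametrised one-form `ξ ↦ A ξ` is a linear functional of the parameter; so is every fixed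
linear combination `√c · Σ_p V_{yp}·curl(A ξ)(p; μ, ν)` (the averaged curl, by `SFWGaussianRung.exists_weight`). [folklore] -/
theorem exists_linearMap_curl_comb (A : E →ₗ[ℝ] (PBond P 0 → ℝ)) (μ ν : Fin P.d) {α : Type*} (V : α → Site P 0 → ℝ) (c : ℝ) :
    ∃ ℓ : α → E →ₗ[ℝ] ℝ, ∀ y ξ, ℓ y ξ = c * ∑ p, V y p * curlAt (A ξ) p μ ν := by
  classical
  let cl : Site P 0 → (PBond P 0 → ℝ) →ₗ[ℝ] ℝ := fun p =>
    LinearMap.proj (R := ℝ) (φ := fun _ : PBond P 0 => ℝ) (⟨p, μ⟩ : PBond P 0)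
      + LinearMap.proj (R := ℝ) (φ := fun _ : PBond P 0 => ℝ) (⟨p.shift μ, ν⟩ : PBond P 0)
      - LinearMap.proj (R := ℝ) (φ := fun _ : PBond P 0 => ℝ) (⟨p.shift ν, μ⟩ : PBond P 0)
      - LinearMap.proj (R := ℝ) (φ := fun _ : PBond P 0 => ℝ) (⟨p, ν⟩ : PBond P 0)
  have hcl : ∀ p (a : PBond P 0 → ℝ), cl p a = curlAt a p μ ν := by
    intro p a
    simp [cl, curlAt]
  refine ⟨fun y => c • ∑ p, V y p • ((cl p).comp A), fun y ξ => ?_⟩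
  simp only [LinearMap.smul_apply, LinearMap.coe_sum, Finset.sum_apply, LinearMap.comp_apply, hcl, smul_eq_mul]

/-- **★★★ THE GAUSSIAN INSTANCE OF `CappedCoarseStiffnessL`, SUB-FAMILY FORM (uncapped, per orientation; `d = 3`)**: for every centred Gaussian
fine one-form `ξ ↦ A ξ` (`ξ ∼ stdGaussian E`) whose plaquette curls in the plane `(μ, ν)` have covariance `≤ σ²·Id`, every `0 ≤ c₀ < 1/2`, every height
`s ≤ m + K`, every `β ≥ 0` with `β·σ²·L^s ≤ 1` and EVERY finite family `S` of level-`s` plaquettes, the quadratic tilt of the linearly averaged curls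
over `S` has free energy `≤ c₀/(1 − 2c₀)` PER MEMBER OF `S` — no volume factor:
`∫ exp(c₀·β·Σ_{y ∈ S} curl(linAvgIter s (A ξ))(y; μ, ν)²) d stdGaussian(ξ) ≤ exp(c₀/(1 − 2c₀)·#S)` (and the integrand is integrable).  The operator constant of
the family is `κ = c₀·βσ²L^s ≤ c₀` (Schur test on the rows `y ∈ S` of the (0.4) weight), its diagonal `≤ c₀·#S`.  Gaussian bookkeeping only: the
interacting law, the nonlinear averaging and [Balaban1985UV3] (5)/(71) are NOT touched; the crux stays open.
[cite: Balaban1985UV3, (7) p.257 and (71) p.273 (the calibration `β_{K−j}θ(K−j)² = p(g_{K−j})²` this instance mirrors)] -/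
theorem gaussianInstance_family (hd : P.d = 3) (μ ν : Fin P.d) (A : E →ₗ[ℝ] (PBond P 0 → ℝ)) {σ2 β c₀ : ℝ} (hσ : 0 ≤ σ2) (hβ : 0 ≤ β)
    (hc0 : 0 ≤ c₀) (hc : 2 * c₀ < 1)
    (hcov : ∀ c : Site P 0 → ℝ, Var[fun ξ => ∑ p, c p * curlAt (A ξ) p μ ν; stdGaussian E] ≤ σ2 * ∑ p, c p ^ 2)
    {s : ℕ} (hs : s ≤ P.m + P.K) (hβσ : β * σ2 * (P.L : ℝ) ^ s ≤ 1) (S : Finset (Site P s)) :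
    Integrable (fun ξ => rexp (c₀ * β * ∑ y ∈ S, curlAt (linAvgIter s (A ξ)) y μ ν ^ 2)) (stdGaussian E) ∧
      ∫ ξ, rexp (c₀ * β * ∑ y ∈ S, curlAt (linAvgIter s (A ξ)) y μ ν ^ 2) ∂stdGaussian E ≤
        rexp (c₀ / (1 - 2 * c₀) * S.card) := by
  obtain ⟨V, hV0, hrow, hcol, hrep⟩ := exists_weight (P := P) μ ν s hs
  -- the constants: `B·R = L^s` in `d = 3`
  have hL : (0 : ℝ) < P.L := Nat.cast_pos.mpr P.L_pos
  have hBR : ((P.L : ℝ) ^ 2 / (P.L : ℝ) ^ P.d) ^ s * ((P.L : ℝ) ^ 2) ^ s = (P.L : ℝ) ^ s := by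
    rw [hd, ← mul_pow, show (P.L : ℝ) ^ 2 / (P.L : ℝ) ^ 3 * (P.L : ℝ) ^ 2 = P.L by field_simp]
  have hcβ : 0 ≤ c₀ * β := mul_nonneg hc0 hβ
  set κ : ℝ := c₀ * (β * σ2 * (P.L : ℝ) ^ s) with hκdef
  have hκ0 : 0 ≤ κ := mul_nonneg hc0 (mul_nonneg (mul_nonneg hβ hσ) (pow_nonneg hL.le s))
  have hκc : κ ≤ c₀ := by rw [hκdef]; exact mul_le_of_le_one_right hc0 hβσ
  have hκ : 2 * κ < 1 := by nlinarith
  -- the rows `y ∈ S` of the weight: same row sums, column sums still `≤ B`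
  set W : ↥S → Site P 0 → ℝ := fun y p => V y p with hWdef
  have hW0 : ∀ y p, 0 ≤ W y p := fun y p => hV0 y p
  have hWrow : ∀ y, ∑ p, W y p = ((P.L : ℝ) ^ 2) ^ s := fun y => hrow y
  have hWcol : ∀ p, ∑ y, W y p ≤ ((P.L : ℝ) ^ 2 / (P.L : ℝ) ^ P.d) ^ s := by
    intro p
    calc ∑ y : ↥S, W y p = ∑ y ∈ S, V y p := Finset.sum_coe_sort S (fun y => V y p)
      _ ≤ ∑ y, V y p := Finset.sum_le_univ_sum_of_nonneg fun y => hV0 y p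
      _ ≤ _ := hcol p
  -- the functionals `ℓ_y(ξ) = √(c₀β)·Σ_p V_{yp} curl(Aξ)(p)` = `√(c₀β)·curl(linAvgIter s (Aξ))(y)`, `y ∈ S`
  obtain ⟨ℓ, hℓ⟩ := exists_linearMap_curl_comb A μ ν W (√(c₀ * β))
  have hℓ' : ∀ (y : ↥S) ξ, ℓ y ξ = √(c₀ * β) * curlAt (linAvgIter s (A ξ)) y μ ν := fun y ξ => by rw [hℓ, hWdef, hrep]
  have hsq : ∀ ξ, ∑ y, ℓ y ξ ^ 2 = c₀ * β * ∑ y ∈ S, curlAt (linAvgIter s (A ξ)) y μ ν ^ 2 := by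
    intro ξ
    rw [Finset.mul_sum, ← Finset.sum_coe_sort S]
    refine Finset.sum_congr rfl fun y _ => ?_
    rw [hℓ', mul_pow, Real.sq_sqrt hcβ]
  -- the operator bound (hypothesis of the toolkit) from the covariance bound and the Schur test
  have hvar : ∀ η : ↥S → ℝ, Var[fun ξ => ∑ y, η y * ℓ y ξ; stdGaussian E] ≤ κ * ∑ y, η y ^ 2 := by
    intro η
    have hfun : (fun ξ => ∑ y, η y * ℓ y ξ) = fun ξ => √(c₀ * β) * ∑ p, (∑ y, η y * W y p) * curlAt (A ξ) p μ ν := by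
      funext ξ
      simp_rw [hℓ]
      calc ∑ y, η y * (√(c₀ * β) * ∑ p, W y p * curlAt (A ξ) p μ ν)
          = ∑ y, ∑ p, √(c₀ * β) * (η y * W y p * curlAt (A ξ) p μ ν) := by
            refine Finset.sum_congr rfl fun y _ => ?_
            rw [Finset.mul_sum, Finset.mul_sum]
            exact Finset.sum_congr rfl fun p _ => by ring
        _ = ∑ p, ∑ y, √(c₀ * β) * (η y * W y p * curlAt (A ξ) p μ ν) := Finset.sum_comm
        _ = √(c₀ * β) * ∑ p, (∑ y, η y * W y p) * curlAt (A ξ) p μ ν := by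
            rw [Finset.mul_sum]
            refine Finset.sum_congr rfl fun p _ => ?_
            rw [Finset.sum_mul, Finset.mul_sum]
    rw [hfun, variance_const_mul, Real.sq_sqrt hcβ]
    calc c₀ * β * Var[fun ξ => ∑ p, (∑ y, η y * W y p) * curlAt (A ξ) p μ ν; stdGaussian E]
        ≤ c₀ * β * (σ2 * ∑ p, (∑ y, η y * W y p) ^ 2) := mul_le_mul_of_nonneg_left (hcov _) hcβ
      _ ≤ c₀ * β * (σ2 * (((P.L : ℝ) ^ 2 / (P.L : ℝ) ^ P.d) ^ s * ((P.L : ℝ) ^ 2) ^ s * ∑ y, η y ^ 2)) :=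
          mul_le_mul_of_nonneg_left (mul_le_mul_of_nonneg_left (sum_sq_sum_mul_weight_le W hW0 hWrow hWcol η) hσ) hcβ
      _ = κ * ∑ y, η y ^ 2 := by rw [hBR, hκdef]; ring
  -- the diagonal (trace) bound
  have hdiag : ∑ y, Var[fun ξ => ℓ y ξ; stdGaussian E] ≤ c₀ * S.card := by
    have hy : ∀ y, Var[fun ξ => ℓ y ξ; stdGaussian E] ≤ c₀ := by
      intro y
      have hfun : (fun ξ => ℓ y ξ) = fun ξ => √(c₀ * β) * ∑ p, W y p * curlAt (A ξ) p μ ν := funext fun ξ => hℓ y ξ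
      rw [hfun, variance_const_mul, Real.sq_sqrt hcβ]
      calc c₀ * β * Var[fun ξ => ∑ p, W y p * curlAt (A ξ) p μ ν; stdGaussian E] ≤ c₀ * β * (σ2 * ∑ p, W y p ^ 2) :=
            mul_le_mul_of_nonneg_left (hcov _) hcβ
        _ ≤ c₀ * β * (σ2 * (((P.L : ℝ) ^ 2 / (P.L : ℝ) ^ P.d) ^ s * ((P.L : ℝ) ^ 2) ^ s)) :=
            mul_le_mul_of_nonneg_left (mul_le_mul_of_nonneg_left (sum_weight_sq_le' W hW0 hWrow hWcol y) hσ) hcβ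
        _ = κ := by rw [hBR, hκdef]; ring
        _ ≤ c₀ := hκc
    calc ∑ y, Var[fun ξ => ℓ y ξ; stdGaussian E] ≤ ∑ _y : ↥S, c₀ := Finset.sum_le_sum fun y _ => hy y
      _ = c₀ * S.card := by rw [Finset.sum_const, Finset.card_univ, Fintype.card_coe, nsmul_eq_mul, mul_comm]
  -- the toolkit
  have hmain := integral_exp_sum_sq_le_of_variance_le ℓ hκ0 hκ hvar
  simp_rw [hsq] at hmain
  refine ⟨hmain.1, hmain.2.trans (Real.exp_le_exp.2 ?_)⟩
  have hk : 0 < 1 - 2 * κ := by linarith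
  have hcc : 0 < 1 - 2 * c₀ := by linarith
  calc (∑ y, Var[fun ξ => ℓ y ξ; stdGaussian E]) / (1 - 2 * κ) ≤ (c₀ * S.card) / (1 - 2 * c₀) :=
        div_le_div₀ (mul_nonneg hc0 (Nat.cast_nonneg _)) hdiag hcc (by linarith)
    _ = c₀ / (1 - 2 * c₀) * S.card := by ring

/-- **★★★ THE GAUSSIAN INSTANCE OF `CappedCoarseStiffnessL` (uncapped, per orientation, ALL level-`s` plaquettes; `d = 3`)**: for every centred
Gaussian fine one-form `ξ ↦ A ξ` (`ξ ∼ stdGaussian E`) whose plaquette curls in the plane `(μ, ν)` have covariance `≤ σ²·Id`, every `0 ≤ c₀ < 1/2`, every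
height `s ≤ m + K` and every `β ≥ 0` with `β·σ²·L^s ≤ 1`, the quadratic tilt of ALL level-`s` linearly averaged curls at once has free energy `≤ c₀/(1 − 2c₀)`
per level-`s` plaquette, uniformly in the volume, `K`, `s` and `L`:
`∫ exp(c₀·β·Σ_{y} curl(linAvgIter s (A ξ))(y; μ, ν)²) d stdGaussian(ξ) ≤ exp(c₀/(1 − 2c₀)·#Site_s)` (and the integrand is integrable) — the sub-family form
at `S = univ`.  Gaussian bookkeeping only; the crux stays open. [cite: Balaban1985UV3, (7) p.257 and (71) p.273] -/
theorem gaussianInstance (hd : P.d = 3) (μ ν : Fin P.d) (A : E →ₗ[ℝ] (PBond P 0 → ℝ)) {σ2 β c₀ : ℝ} (hσ : 0 ≤ σ2) (hβ : 0 ≤ β)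
    (hc0 : 0 ≤ c₀) (hc : 2 * c₀ < 1)
    (hcov : ∀ c : Site P 0 → ℝ, Var[fun ξ => ∑ p, c p * curlAt (A ξ) p μ ν; stdGaussian E] ≤ σ2 * ∑ p, c p ^ 2)
    {s : ℕ} (hs : s ≤ P.m + P.K) (hβσ : β * σ2 * (P.L : ℝ) ^ s ≤ 1) :
    Integrable (fun ξ => rexp (c₀ * β * ∑ y : Site P s, curlAt (linAvgIter s (A ξ)) y μ ν ^ 2)) (stdGaussian E) ∧
      ∫ ξ, rexp (c₀ * β * ∑ y : Site P s, curlAt (linAvgIter s (A ξ)) y μ ν ^ 2) ∂stdGaussian E ≤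
        rexp (c₀ / (1 - 2 * c₀) * Fintype.card (Site P s)) := by
  have h := gaussianInstance_family hd μ ν A hσ hβ hc0 hc hcov hs hβσ Finset.univ
  rwa [Finset.card_univ] at h

/-- **★★★ THE VOLUME-FREE JOINT TAIL OF THE GAUSSIAN MODEL (the EDGE in the organ's uniform currency, every family)**: under the hypotheses of
`gaussianInstance_family`, for every finite family `S` of level-`s` plaquettes and every threshold `θ ≥ 0`,
`stdGaussian{ξ : ∀ y ∈ S, θ ≤ |curl(linAvgIter s (A ξ))(y; μ, ν)|} ≤ exp(−(c₀·βθ² − c₀/(1 − 2c₀))·#S)` — exponential Chebyshev on the sub-family tilt.  With the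
crux's calibration `βθ² = p(g_{K−j})²` this is the joint Peierls bound at rate `c₀·(p² − 1/(1−2c₀))` per member, NO volume prefactor, for ALL families — the
Gaussian form of `stub_uniformLargeFieldCountPos` in the strong packaging of p635820 §3 / the owner's v5q `stub_jointRateHigh` (there: dilute families).  Gaussian
bookkeeping only; nothing about the interacting law. [cite: Balaban1985UV3, (71) p.273] -/
theorem gaussian_jointTail_family (hd : P.d = 3) (μ ν : Fin P.d) (A : E →ₗ[ℝ] (PBond P 0 → ℝ)) {σ2 β c₀ : ℝ} (hσ : 0 ≤ σ2) (hβ : 0 ≤ β)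
    (hc0 : 0 ≤ c₀) (hc : 2 * c₀ < 1)
    (hcov : ∀ c : Site P 0 → ℝ, Var[fun ξ => ∑ p, c p * curlAt (A ξ) p μ ν; stdGaussian E] ≤ σ2 * ∑ p, c p ^ 2)
    {s : ℕ} (hs : s ≤ P.m + P.K) (hβσ : β * σ2 * (P.L : ℝ) ^ s ≤ 1) (S : Finset (Site P s)) {θ : ℝ} (hθ : 0 ≤ θ) :
    (stdGaussian E).real {ξ | ∀ y ∈ S, θ ≤ |curlAt (linAvgIter s (A ξ)) y μ ν|} ≤
      rexp (-(c₀ * β * θ ^ 2 - c₀ / (1 - 2 * c₀)) * S.card) := by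
  obtain ⟨hint, hbd⟩ := gaussianInstance_family hd μ ν A hσ hβ hc0 hc hcov hs hβσ S
  set f : E → ℝ := fun ξ => rexp (c₀ * β * ∑ y ∈ S, curlAt (linAvgIter s (A ξ)) y μ ν ^ 2) with hfdef
  set a : ℝ := rexp (c₀ * β * θ ^ 2 * S.card) with hadef
  have ha : 0 < a := Real.exp_pos _
  -- on the event the tilt is at least `a`
  have hsub : {ξ | ∀ y ∈ S, θ ≤ |curlAt (linAvgIter s (A ξ)) y μ ν|} ⊆ {ξ | a ≤ f ξ} := by
    intro ξ hξ
    simp only [Set.mem_setOf_eq] at hξ ⊢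
    refine Real.exp_le_exp.2 ?_
    have hcβ : 0 ≤ c₀ * β := mul_nonneg hc0 hβ
    calc c₀ * β * θ ^ 2 * S.card = c₀ * β * ∑ _y ∈ S, θ ^ 2 := by rw [Finset.sum_const, nsmul_eq_mul]; ring
      _ ≤ c₀ * β * ∑ y ∈ S, curlAt (linAvgIter s (A ξ)) y μ ν ^ 2 := by
          refine mul_le_mul_of_nonneg_left (Finset.sum_le_sum fun y hy => ?_) hcβ
          calc θ ^ 2 ≤ |curlAt (linAvgIter s (A ξ)) y μ ν| ^ 2 := pow_le_pow_left₀ hθ (hξ y hy) 2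
            _ = curlAt (linAvgIter s (A ξ)) y μ ν ^ 2 := sq_abs _
  -- exponential Chebyshev
  have hcheb : a * (stdGaussian E).real {ξ | a ≤ f ξ} ≤ ∫ ξ, f ξ ∂stdGaussian E :=
    mul_meas_ge_le_integral_of_nonneg (ae_of_all _ fun ξ => (Real.exp_pos _).le) hint a
  have h1 : (stdGaussian E).real {ξ | ∀ y ∈ S, θ ≤ |curlAt (linAvgIter s (A ξ)) y μ ν|} ≤ (∫ ξ, f ξ ∂stdGaussian E) / a := by
    rw [le_div_iff₀ ha, mul_comm]
    exact (mul_le_mul_of_nonneg_left (measureReal_mono hsub) ha.le).trans hcheb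
  refine h1.trans ?_
  rw [div_le_iff₀ ha, hadef, ← Real.exp_add]
  refine hbd.trans (Real.exp_le_exp.2 (le_of_eq ?_))
  ring
/-- **★★★ THE GAUSSIAN INSTANCE IN THE CRUX'S OWN DICTIONARY** (`d = 3`): curl covariance `≤ g_K²·Id = γL^{−K}·Id` (lattice Maxwell at the cut-off
coupling `β_K = (γε_K)⁻¹`, `ε_K = L^{−K}`), tilt coefficient `c₀·(γL^{−(K−j)})⁻¹ = c₀·β_{K−j}` exactly as in `CappedCoarseStiffnessL`, height `j ≤ K`:
`∫ exp(c₀·(γL^{−(K−j)})⁻¹·Σ_{y} curl(linAvgIter j (A ξ))(y; μ, ν)²) d stdGaussian(ξ) ≤ exp(c₀/(1 − 2c₀)·#Site_j)` for EVERY `0 ≤ c₀ < 1/2` and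
EVERY `γ > 0` — the crux's constant structure `∃ (c₀, C₀, γ₁) ∀ (γ, K, j)` with `C₀ = c₀/(1 − 2c₀)`, `γ₁ = 1`, in the linearised theory (route text,
CHEAPEST FALSIFIER (i), now a kernel theorem).  Nothing about the interacting law; the crux stays open. [cite: Balaban1985UV3, (7) p.257 and (71) p.273] -/
theorem gaussianInstance_cruxDictionary (hd : P.d = 3) (μ ν : Fin P.d) (A : E →ₗ[ℝ] (PBond P 0 → ℝ)) {γ c₀ : ℝ} (hγ : 0 < γ)
    (hc0 : 0 ≤ c₀) (hc : 2 * c₀ < 1) {K j : ℕ} (hjK : j ≤ K) (hj : j ≤ P.m + P.K)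
    (hcov : ∀ c : Site P 0 → ℝ,
      Var[fun ξ => ∑ p, c p * curlAt (A ξ) p μ ν; stdGaussian E] ≤ γ * ((P.L : ℝ)⁻¹) ^ K * ∑ p, c p ^ 2) :
    Integrable (fun ξ => rexp (c₀ * (γ * ((P.L : ℝ)⁻¹) ^ (K - j))⁻¹ *
        ∑ y : Site P j, curlAt (linAvgIter j (A ξ)) y μ ν ^ 2)) (stdGaussian E) ∧
      ∫ ξ, rexp (c₀ * (γ * ((P.L : ℝ)⁻¹) ^ (K - j))⁻¹ * ∑ y : Site P j, curlAt (linAvgIter j (A ξ)) y μ ν ^ 2) ∂stdGaussian E ≤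
        rexp (c₀ / (1 - 2 * c₀) * Fintype.card (Site P j)) := by
  have hL : (0 : ℝ) < P.L := Nat.cast_pos.mpr P.L_pos
  have hσ : 0 ≤ γ * ((P.L : ℝ)⁻¹) ^ K := by positivity
  have hβ : 0 ≤ (γ * ((P.L : ℝ)⁻¹) ^ (K - j))⁻¹ := by positivity
  have hβσ : (γ * ((P.L : ℝ)⁻¹) ^ (K - j))⁻¹ * (γ * ((P.L : ℝ)⁻¹) ^ K) * (P.L : ℝ) ^ j ≤ 1 := by
    refine le_of_eq ?_
    obtain ⟨i, rfl⟩ := Nat.exists_eq_add_of_le hjK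
    rw [Nat.add_sub_cancel_left, pow_add]
    have h1 : ((P.L : ℝ)⁻¹) ^ j * (P.L : ℝ) ^ j = 1 := by
      rw [inv_pow, inv_mul_cancel₀ (pow_ne_zero _ hL.ne')]
    have h2 : γ * ((P.L : ℝ)⁻¹) ^ i ≠ 0 := by positivity
    calc (γ * ((P.L : ℝ)⁻¹) ^ i)⁻¹ * (γ * (((P.L : ℝ)⁻¹) ^ j * ((P.L : ℝ)⁻¹) ^ i)) * (P.L : ℝ) ^ j
        = ((γ * ((P.L : ℝ)⁻¹) ^ i)⁻¹ * (γ * ((P.L : ℝ)⁻¹) ^ i)) * (((P.L : ℝ)⁻¹) ^ j * (P.L : ℝ) ^ j) := by ring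
      _ = 1 := by rw [inv_mul_cancel₀ h2, h1, one_mul]
  exact gaussianInstance hd μ ν A hσ hβ hc0 hc hcov hj hβσ

/-! ## §4 The capped tilt and the two registered stubs in the Gaussian model (pointwise domination) -/

/-- **The Gaussian instance of the crux WITH ITS CAP, of the BULK stub and of the EDGE stub at once**: under the hypotheses of
`gaussianInstance`, for every window `θ ≥ 0` and every `q` with `q ≤ β·θ²` (the crux's calibration is `β_{K−j}θ(K−j)² = p(g_{K−j})²`), each of
(capped) `∫ exp(c₀β·Σ_y min(curl_y², θ²))`, (BULK, `stub_subThresholdStiffness`) `∫ exp(c₀β·Σ_y curl_y²·1[|curl_y| < θ])` and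
(EDGE, `stub_uniformLargeFieldCountPos`) `∫ exp(c₀·q·#{y : θ ≤ |curl_y|})` is `≤ exp(c₀/(1 − 2c₀)·#Site_s)` — pointwise `min(d², θ²)`, `d²·1[|d| < θ]`,
`βθ²·1[θ ≤ |d|]` are all `≤ d²·β`-weighted terms of the uncapped tilt.  Gaussian bookkeeping only; the stubs and the crux stay open.
[cite: Balaban1985UV3, (7) p.257 and (71) p.273] -/
theorem gaussianInstance_capped_bulk_edge (hd : P.d = 3) (μ ν : Fin P.d) (A : E →ₗ[ℝ] (PBond P 0 → ℝ)) {σ2 β c₀ : ℝ} (hσ : 0 ≤ σ2)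
    (hβ : 0 ≤ β) (hc0 : 0 ≤ c₀) (hc : 2 * c₀ < 1)
    (hcov : ∀ c : Site P 0 → ℝ, Var[fun ξ => ∑ p, c p * curlAt (A ξ) p μ ν; stdGaussian E] ≤ σ2 * ∑ p, c p ^ 2)
    {s : ℕ} (hs : s ≤ P.m + P.K) (hβσ : β * σ2 * (P.L : ℝ) ^ s ≤ 1) {θ q : ℝ} (hθ : 0 ≤ θ) (hq : q ≤ β * θ ^ 2) :
    (∫ ξ, rexp (c₀ * β * ∑ y : Site P s, min (curlAt (linAvgIter s (A ξ)) y μ ν ^ 2) (θ ^ 2)) ∂stdGaussian E ≤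
        rexp (c₀ / (1 - 2 * c₀) * Fintype.card (Site P s))) ∧
    (∫ ξ, rexp (c₀ * β * ∑ y : Site P s, (if |curlAt (linAvgIter s (A ξ)) y μ ν| < θ then
        curlAt (linAvgIter s (A ξ)) y μ ν ^ 2 else 0)) ∂stdGaussian E ≤ rexp (c₀ / (1 - 2 * c₀) * Fintype.card (Site P s))) ∧
    (∫ ξ, rexp (c₀ * q * ∑ y : Site P s, (if θ ≤ |curlAt (linAvgIter s (A ξ)) y μ ν| then (1 : ℝ) else 0)) ∂stdGaussian E ≤
        rexp (c₀ / (1 - 2 * c₀) * Fintype.card (Site P s))) := by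
  obtain ⟨hint, hbd⟩ := gaussianInstance hd μ ν A hσ hβ hc0 hc hcov hs hβσ
  have hcβ : 0 ≤ c₀ * β := mul_nonneg hc0 hβ
  -- generic domination step
  have dom : ∀ g : E → ℝ, (∀ ξ, g ξ ≤ c₀ * β * ∑ y : Site P s, curlAt (linAvgIter s (A ξ)) y μ ν ^ 2) →
      ∫ ξ, rexp (g ξ) ∂stdGaussian E ≤ rexp (c₀ / (1 - 2 * c₀) * Fintype.card (Site P s)) := by
    intro g hg
    refine (integral_mono_of_nonneg (ae_of_all _ fun ξ => (Real.exp_pos _).le) hint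
      (ae_of_all _ fun ξ => Real.exp_le_exp.2 (hg ξ))).trans hbd
  refine ⟨dom _ fun ξ => ?_, dom _ fun ξ => ?_, dom _ fun ξ => ?_⟩
  · exact mul_le_mul_of_nonneg_left (Finset.sum_le_sum fun y _ => min_le_left _ _) hcβ
  · refine mul_le_mul_of_nonneg_left (Finset.sum_le_sum fun y _ => ?_) hcβ
    split_ifs
    · exact le_rfl
    · exact sq_nonneg _
  · have key : q * ∑ y : Site P s, (if θ ≤ |curlAt (linAvgIter s (A ξ)) y μ ν| then (1 : ℝ) else 0) ≤
        β * ∑ y : Site P s, curlAt (linAvgIter s (A ξ)) y μ ν ^ 2 := by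
      rw [Finset.mul_sum, Finset.mul_sum]
      refine Finset.sum_le_sum fun y _ => ?_
      split_ifs with h
      · rw [mul_one]
        refine hq.trans (mul_le_mul_of_nonneg_left ?_ hβ)
        calc θ ^ 2 ≤ |curlAt (linAvgIter s (A ξ)) y μ ν| ^ 2 := pow_le_pow_left₀ hθ h 2
          _ = curlAt (linAvgIter s (A ξ)) y μ ν ^ 2 := sq_abs _
      · rw [mul_zero]
        exact mul_nonneg hβ (sq_nonneg _)
    calc c₀ * q * ∑ y : Site P s, (if θ ≤ |curlAt (linAvgIter s (A ξ)) y μ ν| then (1 : ℝ) else 0)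
        = c₀ * (q * ∑ y : Site P s, (if θ ≤ |curlAt (linAvgIter s (A ξ)) y μ ν| then (1 : ℝ) else 0)) := by ring
      _ ≤ c₀ * (β * ∑ y : Site P s, curlAt (linAvgIter s (A ξ)) y μ ν ^ 2) := mul_le_mul_of_nonneg_left key hc0
      _ = c₀ * β * ∑ y : Site P s, curlAt (linAvgIter s (A ξ)) y μ ν ^ 2 := by ring

end Instance

end Summit.QuantumFields.YangMills.Theorems.CoarseStiffnessTailGaussianInstance

end
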